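import Summits.Ventures.PercRepro.C026Kernel
import Summits.Ventures.PercRepro.LemmaBPlusK5Def

/-!
# C-026 on the spanning subgraphs of `K₅` (marks `0, 1, 2`), decided by the kernel (p5, gen 7)

`Check26 k5 0 1 2` runs over the `2^10 = 1 024` joins `u` of `K₅` and, for each, over the `2^{|u|}`
points of the face `[⊥, u]` — the full cube of the spanning subgraph with edge set `u` —
`Σ_u 2^{|u|} = 3^10 = 59 049` kernel evaluations of the packed `kernel26Z + 1`, with one `1 024`-row
table of the marking `0, 1, 2` (typer-1's `C017K5.lean`, with C-026's kernel).  Three cost-balanced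
slices (`≈ 20 000` points each, `Range26`) chain to **`check26_k5 : k5.Check26 0 1 2 = true`**.
-/

namespace PercRepro

namespace Examples

open MultiGraph

/-- Slice 0: joins `u ∈ [0, 540)` (20 025 face points). -/
theorem k5_26_slice_0 : k5.Range26 0 1 2 0 540 := by decide +kernel

/-- Slice 1: joins `u ∈ [540, 891)` (20 120 face points). -/
theorem k5_26_slice_1 : k5.Range26 0 1 2 540 891 := by decide +kernel

/-- Slice 2: joins `u ∈ [891, 1024)` (18 904 face points). -/
theorem k5_26_slice_2 : k5.Range26 0 1 2 891 1024 := by decide +kernel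

/-- **The C-026 class sum is nonnegative on every face `[⊥, u]` of `K₅` with marks `0, 1, 2`** (the
three slices chained). -/
theorem check26_k5 : k5.Check26 0 1 2 = true :=
  k5.check26_of_range26 0 1 2
    (k5.range26_trans 0 1 2 (k5.range26_trans 0 1 2 k5_26_slice_0 k5_26_slice_1) k5_26_slice_2)

end Examples

end PercRepro
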